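import Literature.AnabelianGeometry.EtaleTheta.Discharge.Sec2ProfiniteCompletion
import Literature.AnabelianGeometry.SemiGraphs.TemperedAnabelian
import Mathlib.Topology.Algebra.ClopenNhdofOne

/-!
# [EtTh] Lemma 2.17 (ii): the completion of a discrete quotient `Π/N` as a quotient of `Π̂`

Mochizuki, *The Étale Theta Function and its Frobenioid-theoretic Manifestations* [EtTh],
Publ. RIMS 45 (2009), §2, Lemma 2.17 (ii), PRIMS text p.59 (printed p.285; locators `p.N` = PDF
pages of the PRIMS text; bib key `MochizukiEtTh2009`): "(ii) … follows immediately from assertion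
(i) by applying assertion (i) to quotients of `Π` by characteristic open subgroups of `Π`".

PROOF-ONLY plumbing (no definitions, no named facts) for that step, over L3's frozen predicate
`SemiGraphs.IsProfiniteCompletion (ι : Π →ₜ* Π̂)`: for an open normal `N ⊴ Π` the homomorphism
`ψ_N : Π̂ → (Π/N)^` to Mathlib's profinite completion of the discrete quotient
(`exists_hom_completion_quotient`), characterised level-wise — for a finite-index normal
`M ⊴ Π/N` with preimage `M' ⊴ Π` and the open normal `V ⊴ Π̂` with `ι⁻¹(V) = M'`
(`IsProfiniteCompletion.comap_surjective`; `V` is unique, `eq_of_comap_eq_comap_of_denseRange`), the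
`M`-component of `ψ_N(x)` is the class of `g` iff `x ∈ ι(g) · V`; every open normal `V ⊴ Π̂` with
`N ≤ ι⁻¹(V)` is seen at some level (`exists_level`); points of `Π̂` are separated by open normal
subgroups (`eq_one_of_forall_mem_openNormalSubgroup`).  Consumed by
`Discharge/Sec2DiscreteNormalizersTempered.lean`.

Honest framing: classical topological group theory; nothing here concerns [IUTchIII] Cor. 3.12.
-/

namespace Literature.AnabelianGeometry.EtaleTheta.DiscreteNormalizers

open CategoryTheory ProfiniteGrp ProfiniteGrp.ProfiniteCompletion Topology
open Literature.AnabelianGeometry.SemiGraphs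

universe u v

variable {P : Type u} [Group P] [TopologicalSpace P]
variable {Ph : Type v} [Group Ph] [TopologicalSpace Ph] [IsTopologicalGroup Ph]

/-! ### Open normal subgroups of the completion are determined by their preimages -/

/-- If `ι : P → P̂` has dense image and `V, W ⊴ P̂` are open with `ι⁻¹(V) ⊆ ι⁻¹(W)`, then `V ⊆ W`.
[cite: MochizukiEtTh2009, Lem 2.17(ii) p.59] -/
theorem le_of_comap_le_comap_of_denseRange (ι : P →ₜ* Ph) (hd : DenseRange ι)
    {V W : Subgroup Ph} (hV : IsOpen (V : Set Ph)) (hW : IsOpen (W : Set Ph))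
    (h : V.comap ι.toMonoidHom ≤ W.comap ι.toMonoidHom) : V ≤ W := by
  intro v hv
  -- pick `g` with `ι g ∈ v · (V ∩ W)`
  have hopen : IsOpen {y : Ph | v⁻¹ * y ∈ (V : Set Ph) ∧ v⁻¹ * y ∈ (W : Set Ph)} :=
    ((hV.preimage (continuous_const.mul continuous_id)).inter
      (hW.preimage (continuous_const.mul continuous_id)))
  obtain ⟨g, hgV, hgW⟩ := hd.exists_mem_open hopen ⟨v, by simp [V.one_mem, W.one_mem]⟩
  have hgV' : ι g ∈ V := by
    have := V.mul_mem hv hgV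
    simpa using this
  have hgW' : ι g ∈ W := h hgV'
  have : v⁻¹ ∈ W := by
    have := W.mul_mem hgW (W.inv_mem hgW')
    simpa using this
  simpa using W.inv_mem this

/-- With `comap` equal, the open normal subgroups coincide. [cite: MochizukiEtTh2009, Lem 2.17(ii) p.59] -/
theorem eq_of_comap_eq_comap_of_denseRange (ι : P →ₜ* Ph) (hd : DenseRange ι)
    {V W : Subgroup Ph} (hV : IsOpen (V : Set Ph)) (hW : IsOpen (W : Set Ph))
    (h : V.comap ι.toMonoidHom = W.comap ι.toMonoidHom) : V = W :=
  le_antisymm (le_of_comap_le_comap_of_denseRange ι hd hV hW h.le)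
    (le_of_comap_le_comap_of_denseRange ι hd hW hV h.ge)

/-- Density: every element of `P̂` is `ι(g) · v` with `v` in a given open subgroup `V`.
[cite: MochizukiEtTh2009, Lem 2.17(ii) p.59] -/
theorem exists_inv_mul_mem_of_denseRange (ι : P →ₜ* Ph) (hd : DenseRange ι)
    {V : Subgroup Ph} (hV : IsOpen (V : Set Ph)) (x : Ph) : ∃ g : P, x⁻¹ * ι g ∈ V := by
  have hopen : IsOpen {y : Ph | x⁻¹ * y ∈ (V : Set Ph)} :=
    hV.preimage (continuous_const.mul continuous_id)
  obtain ⟨g, hg⟩ := hd.exists_mem_open hopen ⟨x, by simp [V.one_mem]⟩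
  exact ⟨g, hg⟩

/-! ### The completion of a discrete quotient `P ⧸ N` as a quotient of `P̂` -/

/-- **"Applying (i) to quotients of `Π` by open subgroups"** (p.59): for an open normal subgroup
`N ⊴ Π` of a topological group with profinite completion `ι : Π → Π̂` (L3's `IsProfiniteCompletion`),
there is a homomorphism `ψ : Π̂ → (Π/N)^` to Mathlib's profinite completion of the discrete quotient
`Π/N`, characterised level-wise: for a finite-index normal `M ⊴ Π/N` with preimage `M' ⊴ Π` and THE
open normal `V ⊴ Π̂` with `ι⁻¹(V) = M'`, the `M`-component of `ψ(x)` is the class of `g` iff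
`x ∈ ι(g) · V`.  In particular `ψ ∘ ι` is the canonical map of `Π/N`.
[cite: MochizukiEtTh2009, Lem 2.17(ii) p.59] -/
theorem exists_hom_completion_quotient [IsTopologicalGroup P] (ι : P →ₜ* Ph) (hι : IsProfiniteCompletion ι)
    (N : OpenNormalSubgroup P) :
    ∃ ψ : Ph →* completion (GrpCat.of (P ⧸ N.toSubgroup)),
      (∀ M : FiniteIndexNormalSubgroup (P ⧸ N.toSubgroup), ∃ V : OpenNormalSubgroup Ph,
        M.toSubgroup.comap (QuotientGroup.mk' N.toSubgroup) = V.toSubgroup.comap ι.toMonoidHom) ∧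
      (∀ (p : P) (M : FiniteIndexNormalSubgroup (P ⧸ N.toSubgroup)),
        (ψ (ι p)).val M = (QuotientGroup.mk (QuotientGroup.mk p : P ⧸ N.toSubgroup) :
            (P ⧸ N.toSubgroup) ⧸ M.toSubgroup)) ∧
      ∀ (x : Ph) (M : FiniteIndexNormalSubgroup (P ⧸ N.toSubgroup)) (g : P)
        (V : OpenNormalSubgroup Ph),
        M.toSubgroup.comap (QuotientGroup.mk' N.toSubgroup) = V.toSubgroup.comap ι.toMonoidHom →
        ((ψ x).val M = (QuotientGroup.mk (QuotientGroup.mk g : P ⧸ N.toSubgroup) :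
            (P ⧸ N.toSubgroup) ⧸ M.toSubgroup) ↔ x⁻¹ * ι g ∈ V) := by
  classical
  haveI : CompactSpace Ph := hι.compactSpace
  -- the preimages `M' = U M` of the finite-index normal subgroups `M ⊴ P/N`
  have hUopen : ∀ M : FiniteIndexNormalSubgroup (P ⧸ N.toSubgroup),
      IsOpen ((M.toSubgroup.comap (QuotientGroup.mk' N.toSubgroup) : Subgroup P) : Set P) := by
    intro M
    refine Subgroup.isOpen_mono (H₁ := N.toSubgroup) ?_ N.toOpenSubgroup.isOpen
    intro n hn
    change (QuotientGroup.mk' N.toSubgroup n) ∈ M.toSubgroup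
    have h1 : QuotientGroup.mk' N.toSubgroup n = 1 := by
      rw [QuotientGroup.mk'_apply, QuotientGroup.eq_one_iff]
      exact hn
    rw [h1]
    exact one_mem _
  let U : FiniteIndexNormalSubgroup (P ⧸ N.toSubgroup) → OpenNormalSubgroup P := fun M =>
    { toOpenSubgroup := ⟨M.toSubgroup.comap (QuotientGroup.mk' N.toSubgroup), hUopen M⟩
      isNormal' := Subgroup.Normal.comap inferInstance _ }
  have hUdef : ∀ M, (U M).toSubgroup = M.toSubgroup.comap (QuotientGroup.mk' N.toSubgroup) :=
    fun M => rfl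
  have hUfi : ∀ M, (U M).toSubgroup.FiniteIndex := by
    intro M
    rw [hUdef, Subgroup.finiteIndex_iff,
      M.toSubgroup.index_comap_of_surjective (QuotientGroup.mk'_surjective N.toSubgroup)]
    exact Subgroup.FiniteIndex.index_ne_zero
  have hUmono : ∀ M₁ M₂ : FiniteIndexNormalSubgroup (P ⧸ N.toSubgroup), M₁ ≤ M₂ →
      (U M₁).toSubgroup ≤ (U M₂).toSubgroup := fun M₁ M₂ h x hx => h hx
  -- the open normal subgroups `V M ⊴ P̂` with `ι⁻¹(V M) = U M`
  choose V hV using fun M => hι.comap_surjective (U M) (hUfi M)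
  -- representatives
  have hrep : ∀ (x : Ph) (M : FiniteIndexNormalSubgroup (P ⧸ N.toSubgroup)),
      ∃ g : P, x⁻¹ * ι g ∈ (V M).toSubgroup :=
    fun x M => exists_inv_mul_mem_of_denseRange ι hι.denseRange (V M).toOpenSubgroup.isOpen x
  choose g hg using hrep
  -- membership in `U M` through `V M`
  have hmemU : ∀ (M : FiniteIndexNormalSubgroup (P ⧸ N.toSubgroup)) (p : P),
      p ∈ (U M).toSubgroup ↔ ι p ∈ (V M).toSubgroup := by
    intro M p
    rw [hV M]
    rfl
  -- well-definedness of the class of a representative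
  have hwd : ∀ (x : Ph) (M : FiniteIndexNormalSubgroup (P ⧸ N.toSubgroup)) (g₁ g₂ : P),
      x⁻¹ * ι g₁ ∈ (V M).toSubgroup → x⁻¹ * ι g₂ ∈ (V M).toSubgroup →
      (QuotientGroup.mk (QuotientGroup.mk g₁ : P ⧸ N.toSubgroup) : (P ⧸ N.toSubgroup) ⧸ M.toSubgroup) =
        QuotientGroup.mk (QuotientGroup.mk g₂) := by
    intro x M g₁ g₂ h1 h2
    apply QuotientGroup.eq.mpr
    rw [← QuotientGroup.mk_inv, ← QuotientGroup.mk_mul]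
    change g₁⁻¹ * g₂ ∈ (U M).toSubgroup
    rw [hmemU]
    have := (V M).toSubgroup.mul_mem ((V M).toSubgroup.inv_mem h1) h2
    simpa [map_mul, map_inv, mul_assoc] using this
  -- the coherent family attached to `x`
  have hcoh : ∀ x : Ph, ∃ e : completion (GrpCat.of (P ⧸ N.toSubgroup)),
      ∀ M, e.val M = (QuotientGroup.mk (QuotientGroup.mk (g x M) : P ⧸ N.toSubgroup) :
        (P ⧸ N.toSubgroup) ⧸ M.toSubgroup) := by
    intro x
    refine exists_val_eq_of_coherent (fun M => (QuotientGroup.mk (g x M) : P ⧸ N.toSubgroup)) ?_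
    intro M₁ M₂ hle
    have hVle : (V M₁).toSubgroup ≤ (V M₂).toSubgroup :=
      le_of_comap_le_comap_of_denseRange ι hι.denseRange (V M₁).toOpenSubgroup.isOpen
        (V M₂).toOpenSubgroup.isOpen (by rw [← hV M₁, ← hV M₂]; exact hUmono M₁ M₂ hle)
    exact hwd x M₂ _ _ (hVle (hg x M₁)) (hg x M₂)
  choose e he using hcoh
  -- `e` is multiplicative
  have hmul : ∀ x y : Ph, e (x * y) = e x * e y := by
    intro x y
    apply ext_val
    intro M
    obtain ⟨π, hπ⟩ := exists_proj M
    rw [← hπ, ← hπ, map_mul, hπ, hπ, hπ, he, he, he, ← QuotientGroup.mk_mul, ← QuotientGroup.mk_mul]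
    apply hwd (x * y) M
    · exact hg (x * y) M
    · -- (xy)⁻¹ ι(g x M * g y M) = y⁻¹ (x⁻¹ ι(g x M)) y * (y⁻¹ ι (g y M))
      have h1 : y⁻¹ * (x⁻¹ * ι (g x M)) * y ∈ (V M).toSubgroup :=
        (V M).isNormal'.conj_mem' _ (hg x M) y  -- need the y⁻¹ _ y form
      have h2 := (V M).toSubgroup.mul_mem h1 (hg y M)
      simpa [map_mul, mul_assoc] using h2
  refine ⟨MonoidHom.mk' e hmul, fun M => ⟨V M, hV M⟩, ?_, ?_⟩
  · intro p M
    change (e (ι p)).val M = _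
    rw [he]
    exact hwd (ι p) M _ _ (hg (ι p) M) (by simp)
  intro x M p W hW
  -- `W = V M`
  have hWV : W.toSubgroup = (V M).toSubgroup := by
    apply eq_of_comap_eq_comap_of_denseRange ι hι.denseRange W.toOpenSubgroup.isOpen
      (V M).toOpenSubgroup.isOpen
    rw [← hW, ← hV M]
  change (e x).val M = _ ↔ x⁻¹ * ι p ∈ W.toSubgroup
  rw [he, hWV]
  constructor
  · intro h
    have h' : (g x M)⁻¹ * p ∈ (U M).toSubgroup := by
      have := QuotientGroup.eq.mp h
      rwa [← QuotientGroup.mk_inv, ← QuotientGroup.mk_mul] at this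
    rw [hmemU] at h'
    have := (V M).toSubgroup.mul_mem (hg x M) h'
    simpa [map_mul, map_inv, mul_assoc] using this
  · intro h
    exact hwd x M _ _ (hg x M) h

/-- Every open normal subgroup `V ⊴ P̂` whose preimage contains the open normal `N ⊴ Π` is "seen"
at a finite level of `Π/N`: `ι⁻¹(V)/N` is a finite-index normal subgroup of `Π/N` with preimage
`ι⁻¹(V)`. [cite: MochizukiEtTh2009, Lem 2.17(ii) p.59] -/
theorem exists_level [IsTopologicalGroup P] (ι : P →ₜ* Ph) (hι : IsProfiniteCompletion ι)
    (N : OpenNormalSubgroup P) (V : OpenNormalSubgroup Ph)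
    (hNV : N.toSubgroup ≤ V.toSubgroup.comap ι.toMonoidHom) :
    ∃ M : FiniteIndexNormalSubgroup (P ⧸ N.toSubgroup),
      M.toSubgroup.comap (QuotientGroup.mk' N.toSubgroup) = V.toSubgroup.comap ι.toMonoidHom := by
  haveI : CompactSpace Ph := hι.compactSpace
  -- `ι⁻¹(V)` has finite index: `P/ι⁻¹(V)` embeds into the finite group `P̂/V`
  haveI : (V.toSubgroup.comap ι.toMonoidHom).FiniteIndex := by
    haveI : Finite (Ph ⧸ V.toSubgroup) :=
      Subgroup.quotient_finite_of_isOpen V.toSubgroup V.toOpenSubgroup.isOpen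
    let f : P →* Ph ⧸ V.toSubgroup := (QuotientGroup.mk' V.toSubgroup).comp ι.toMonoidHom
    have hker : f.ker = V.toSubgroup.comap ι.toMonoidHom := by
      ext p
      simp [f, MonoidHom.mem_ker, QuotientGroup.eq_one_iff]
    haveI : Finite f.range := inferInstance
    rw [← hker]
    infer_instance
  haveI hn : ((V.toSubgroup.comap ι.toMonoidHom).map (QuotientGroup.mk' N.toSubgroup)).Normal :=
    Subgroup.Normal.map inferInstance _ (QuotientGroup.mk'_surjective N.toSubgroup)
  haveI : ((V.toSubgroup.comap ι.toMonoidHom).map (QuotientGroup.mk' N.toSubgroup)).FiniteIndex := by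
    rw [Subgroup.finiteIndex_iff]
    exact ne_zero_of_dvd_ne_zero Subgroup.FiniteIndex.index_ne_zero
      (Subgroup.index_map_dvd _ (QuotientGroup.mk'_surjective N.toSubgroup))
  refine ⟨FiniteIndexNormalSubgroup.ofSubgroup
    ((V.toSubgroup.comap ι.toMonoidHom).map (QuotientGroup.mk' N.toSubgroup)), ?_⟩
  rw [FiniteIndexNormalSubgroup.toSubgroup_ofSubgroup, Subgroup.comap_map_eq, QuotientGroup.ker_mk',
    sup_eq_left.mpr hNV]

/-- In a compact Hausdorff totally disconnected group an element lying in every open normal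
subgroup is trivial. [cite: MochizukiEtTh2009, Lem 2.17(ii) p.59] -/
theorem eq_one_of_forall_mem_openNormalSubgroup [CompactSpace Ph] [T2Space Ph]
    [TotallyDisconnectedSpace Ph] {y : Ph} (hy : ∀ V : OpenNormalSubgroup Ph, y ∈ V) : y = 1 := by
  by_contra hne
  obtain ⟨V, hV⟩ := ProfiniteGrp.exist_openNormalSubgroup_sub_open_nhds_of_one
    (isOpen_compl_singleton (x := y)) (by simpa using fun h => hne h.symm)
  exact hV (hy V) rfl

end Literature.AnabelianGeometry.EtaleTheta.DiscreteNormalizers
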